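import Summits.Ventures.PercRepro.S2IndepFiveCount

/-!
# PercRepro — S2: THE COBASIS LEVER, I — A TRIANGLE HAS A DISJOINT CIRCUIT OF `≤ 4` ELEMENTS ONCE `s₃ ≥ 5`
(p7, gen 6; sub-claim S2; the cells `(20, 6)` and `(19, 6)`)

A member `B` of `U(p, 5)` with `|B| = d` (the corank) has a complement of `p` elements and rank `p`: a BASIS. So `B`
meets every circuit. At corank `d = 6` every rank-`5` set of `U` with `6` elements is such a set, and the count of
the `6`-sets `B = T ∪ Q` containing a triangle `T` (`|Q| = 3`, `Q ⊆ E ∖ T`) can use it (S2CobasisCount): if some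
circuit `C` with `≤ 4` elements is disjoint from `T`, then `Q` must meet `C`.

THIS FILE: such a circuit exists as soon as `s₃ ≥ 5` (only (C1) is used — lines have `≤ 3` points, so two distinct
triangles share `≤ 1` point): among the other `≥ 4` triangles either one is disjoint from `T`, or — each meeting `T`
in exactly one point, by the pigeonhole on the three points of `T` — two of them, `T' = {t, a, b}` and
`T'' = {t, c, d}`, pass through the same point `t` of `T`; then `r(T' ∪ T'') ≤ r(T') + r(T'') − r({t}) = 3` by
submodularity, so the `4`-set `{a, b, c, d}` is dependent and contains a circuit disjoint from `T`:
**`exists_circuit_le_four_disjoint_of_five_triangles`**. Axioms: standard.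
-/

open scoped Matroid

namespace PercRepro

namespace S2

open Set Finset

variable {α : Type} {M : Matroid α}

open scoped Classical in
/-- **Two triangles through a common point `t` of a third triangle `T`** (all distinct, under (C1)): the union of the two
minus `t` is a `4`-point set of rank `≤ 3`, hence contains a circuit of `≤ 4` elements disjoint from `T`. -/
theorem exists_circuit_disjoint_of_two_triangles_through (hC1 : ∀ L ⊆ M.E, M.eRk L = 2 → L.ncard ≤ 3)
    {T T' T'' : Finset α} (hT : M.IsCircuit (T : Set α)) (hT3 : T.card = 3)
    (hT' : M.IsCircuit (T' : Set α)) (hT'3 : T'.card = 3)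
    (hT'' : M.IsCircuit (T'' : Set α)) (hT''3 : T''.card = 3)
    (hne' : T' ≠ T) (hne'' : T'' ≠ T) (hne : T' ≠ T'') {t : α} (ht : t ∈ T) (ht' : t ∈ T') (ht'' : t ∈ T'') :
    ∃ C : Set α, M.IsCircuit C ∧ C.ncard ≤ 4 ∧ Disjoint C (T : Set α) := by
  have hi := card_inter_le_one_of_triangles hC1 hT' hT'3 hT'' hT''3 hne
  have hi' := card_inter_le_one_of_triangles hC1 hT' hT'3 hT hT3 hne'
  have hi'' := card_inter_le_one_of_triangles hC1 hT'' hT''3 hT hT3 hne''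
  -- `T' ∩ T'' = {t}`
  have hint : T' ∩ T'' = {t} := by
    rw [Finset.eq_singleton_iff_unique_mem]
    refine ⟨Finset.mem_inter.2 ⟨ht', ht''⟩, fun x hx => ?_⟩
    by_contra hxt
    have h2 : ({x, t} : Finset α) ⊆ T' ∩ T'' := by
      intro y hy
      rw [Finset.mem_insert, Finset.mem_singleton] at hy
      rcases hy with rfl | rfl
      · exact hx
      · exact Finset.mem_inter.2 ⟨ht', ht''⟩
    have := Finset.card_le_card h2
    rw [Finset.card_pair hxt] at this
    omega
  -- the `4`-set `W = (T' ∪ T'') ∖ {t}`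
  set W : Finset α := (T' ∪ T'').erase t with hW
  have hWcard : W.card = 4 := by
    rw [hW, Finset.card_erase_of_mem (Finset.mem_union.2 (Or.inl ht'))]
    have := Finset.card_union_add_card_inter T' T''
    rw [hint, Finset.card_singleton] at this
    omega
  -- the circuits have rank `2`, the point `t` rank `1`
  have heT' : M.eRk (T' : Set α) = 2 := by
    have h := hT'.eRk_add_one_eq
    rw [Set.encard_coe_eq_coe_finsetCard, hT'3] at h
    have h' : M.eRk (T' : Set α) + 1 = 2 + 1 := by rw [h]; rfl
    exact WithTop.add_right_cancel (by decide) h'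
  have heT'' : M.eRk (T'' : Set α) = 2 := by
    have h := hT''.eRk_add_one_eq
    rw [Set.encard_coe_eq_coe_finsetCard, hT''3] at h
    have h' : M.eRk (T'' : Set α) + 1 = 2 + 1 := by rw [h]; rfl
    exact WithTop.add_right_cancel (by decide) h'
  have het : M.eRk ((T' ∩ T'' : Finset α) : Set α) = 1 := by
    have hss : ((T' ∩ T'' : Finset α) : Set α) ⊂ (T' : Set α) := by
      rw [Finset.coe_ssubset, hint]
      refine Finset.ssubset_iff_subset_ne.2 ⟨Finset.singleton_subset_iff.2 ht', fun h => ?_⟩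
      rw [← h, Finset.card_singleton] at hT'3
      omega
    have hind : M.Indep ((T' ∩ T'' : Finset α) : Set α) := hT'.ssubset_indep hss
    rw [hind.eRk_eq_encard, Set.encard_coe_eq_coe_finsetCard, hint, Finset.card_singleton]
    rfl
  -- submodularity: `r(T' ∩ T'') + r(T' ∪ T'') ≤ r(T') + r(T'')`, so `r(T' ∪ T'') ≤ 3`
  have hsub := M.eRk_inter_add_eRk_union_le (T' : Set α) (T'' : Set α)
  rw [← Finset.coe_inter, het, heT', heT''] at hsub
  have hU3 : M.eRk ((T' : Set α) ∪ (T'' : Set α)) ≤ 3 := by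
    have h13 : (2 : ℕ∞) + 2 = 1 + 3 := by decide
    rw [h13] at hsub
    exact (WithTop.add_le_add_iff_left (by decide : (1 : ℕ∞) ≠ ⊤)).1 hsub
  have hWsub : (W : Set α) ⊆ (T' : Set α) ∪ (T'' : Set α) := by
    rw [hW, Finset.coe_erase, Finset.coe_union]
    exact Set.sdiff_subset
  have hWE : (W : Set α) ⊆ M.E :=
    hWsub.trans (Set.union_subset hT'.subset_ground hT''.subset_ground)
  have hWr : M.eRk (W : Set α) ≤ 3 := (M.eRk_mono hWsub).trans hU3
  -- `W` is dependent: an independent `4`-set would have rank `4`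
  have hWdep : M.Dep (W : Set α) := by
    rw [Matroid.dep_iff]
    refine ⟨fun hind => ?_, hWE⟩
    rw [hind.eRk_eq_encard, Set.encard_coe_eq_coe_finsetCard, hWcard] at hWr
    exact absurd hWr (by decide)
  obtain ⟨C, hCW, hC⟩ := hWdep.exists_isCircuit_subset
  refine ⟨C, hC, ?_, ?_⟩
  · have := Set.ncard_le_ncard hCW (Finset.finite_toSet W)
    rw [Set.ncard_coe_finset, hWcard] at this
    exact this
  · refine Set.disjoint_of_subset_left hCW ?_
    rw [Finset.disjoint_coe, Finset.disjoint_left]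
    intro x hxW hxT
    rw [hW, Finset.mem_erase, Finset.mem_union] at hxW
    obtain ⟨hxt, hx⟩ := hxW
    rcases hx with hx | hx
    · have h2 : ({x, t} : Finset α) ⊆ T' ∩ T := by
        intro y hy
        rw [Finset.mem_insert, Finset.mem_singleton] at hy
        rcases hy with rfl | rfl
        · exact Finset.mem_inter.2 ⟨hx, hxT⟩
        · exact Finset.mem_inter.2 ⟨ht', ht⟩
      have := Finset.card_le_card h2
      rw [Finset.card_pair hxt] at this
      omega
    · have h2 : ({x, t} : Finset α) ⊆ T'' ∩ T := by
        intro y hy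
        rw [Finset.mem_insert, Finset.mem_singleton] at hy
        rcases hy with rfl | rfl
        · exact Finset.mem_inter.2 ⟨hx, hxT⟩
        · exact Finset.mem_inter.2 ⟨ht'', ht⟩
      have := Finset.card_le_card h2
      rw [Finset.card_pair hxt] at this
      omega

open scoped Classical in
/-- **Lemma A — a disjoint small circuit for every triangle once there are `≥ 5` triangles** (under (C1)): for every
triangle `T` of a family `T3` of `≥ 5` triangles there is a circuit `C` with `≤ 4` elements and `C ∩ T = ∅`. -/
theorem exists_circuit_le_four_disjoint_of_five_triangles (hC1 : ∀ L ⊆ M.E, M.eRk L = 2 → L.ncard ≤ 3)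
    (T3 : Finset (Finset α)) (hT3 : ∀ T ∈ T3, M.IsCircuit (T : Set α) ∧ T.card = 3) (h5 : 5 ≤ T3.card)
    {T : Finset α} (hT : T ∈ T3) :
    ∃ C : Set α, M.IsCircuit C ∧ C.ncard ≤ 4 ∧ Disjoint C (T : Set α) := by
  obtain ⟨hTc, hTc3⟩ := hT3 T hT
  set O := T3.erase T with hO
  have hOcard : 4 ≤ O.card := by
    rw [hO, Finset.card_erase_of_mem hT]
    omega
  by_cases hdisj : ∃ T' ∈ O, T' ∩ T = ∅
  · obtain ⟨T', hT', hTT'⟩ := hdisj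
    obtain ⟨hT'c, hT'3⟩ := hT3 T' (Finset.mem_of_mem_erase hT')
    refine ⟨T', hT'c, ?_, ?_⟩
    · rw [Set.ncard_coe_finset, hT'3]
      norm_num
    · rw [Finset.disjoint_coe]
      exact Finset.disjoint_iff_inter_eq_empty.2 hTT'
  · push Not at hdisj
    have hne : ∀ T' ∈ O, (T' ∩ T).Nonempty := hdisj
    choose g hg using hne
    have ht0 : T.Nonempty := Finset.card_pos.1 (by omega)
    let f : Finset α → α := fun T' => if h : T' ∈ O then g T' h else ht0.choose
    have hf : ∀ T' ∈ O, f T' ∈ T := by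
      intro T' hT'
      simp only [f, dif_pos hT']
      exact (Finset.mem_inter.1 (hg T' hT')).2
    obtain ⟨T', hT', T'', hT'', hne', hfeq⟩ :=
      Finset.exists_ne_map_eq_of_card_lt_of_maps_to (by omega : T.card < O.card) hf
    have ht' : f T' ∈ T' := by
      simp only [f, dif_pos hT']
      exact (Finset.mem_inter.1 (hg T' hT')).1
    have ht'' : f T' ∈ T'' := by
      rw [hfeq]
      simp only [f, dif_pos hT'']
      exact (Finset.mem_inter.1 (hg T'' hT'')).1
    obtain ⟨hT'c, hT'3⟩ := hT3 T' (Finset.mem_of_mem_erase hT')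
    obtain ⟨hT''c, hT''3⟩ := hT3 T'' (Finset.mem_of_mem_erase hT'')
    exact exists_circuit_disjoint_of_two_triangles_through hC1 hTc hTc3 hT'c hT'3 hT''c hT''3
      (Finset.ne_of_mem_erase hT') (Finset.ne_of_mem_erase hT'') hne' (hf T' hT') ht' ht''


end S2

end PercRepro
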